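import Summits.AnomalousDissipation.AnomalousDissipation.Theorems.SolenoidalFractalHomogenisationPermissibleFractalCarrierTime
import Summits.AnomalousDissipation.AnomalousDissipation.Theorems.SolenoidalFractalHomogenisationPermissibleFractalCarrierSeries

/-!
# The analytic half of the crux `PermissibleFractalCarrier`: permissible data have a regular carrier
(route `AnomalousDissipation/SolenoidalFractalHomogenisation`, crux K3 = stmt-AnomalousDissipation-19073, registered
stub `stub_regular` of the planner's BC3 birth skeleton `Cruxes.PermissibleFractalCarrier.Birth`; support seat
ad-sawtooth-support g7, cell ad-ideate)

`stub_regular`: a `Permissible` fractal-carrier datum with the amplitude law `a_m ≤ N_m^{7/8}` is `Regular` — its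
level series converges pointwise, the sum is `C⁰_t C^{0,1/16}_x`, time-periodic (period `physPeriod 1`) and weakly
divergence free at every time.

Proof: nested lattices give `N_m ≥ 2^m` (`two_pow_le_N`); with the amplitude law the level sizes
`‖level m t‖_∞ ≤ k a_m/(2π N_m)` and `‖level m t‖_{C^{0,1/16}} ≤ 7k a_m N_m^{−15/16}` are both `≤ (7k) N_m^{−1/16}`,
a summable (geometric) majorant; the levels are continuous in time in `C^{0,1/16}` (`…Time`), so the sum is
`ContinuousInHolderOn` by Tannery (`…Series`); periodicity is `periodic_carrier` (commensurability); weak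
divergence-freeness passes to the sum by `integral_tsum`.
-/

set_option linter.dupNamespace false

noncomputable section

namespace Summit.AnomalousDissipation.AnomalousDissipation.Theorems.SolenoidalFractalHomogenisation.PermissibleCarrier

open Set Filter Topology MeasureTheory
open scoped ENNReal NNReal InnerProductSpace
open Literature.Analysis Literature.Analysis.FunctionSpaces Literature.Analysis.FunctionSpaces.Torus
open Literature.Analysis.FluidPDE Literature.Analysis.FluidPDE.LatticeShear

variable {k : ℕ}

/-! ## §1 The geometric majorant -/

/-- Nested lattices: `2^m ≤ N_m`. [cite: ArmstrongVicol2025, §3 (3.42) (super-geometric scale separation)] -/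
theorem two_pow_le_N (D : FractalCarrierData k) (hP : D.Permissible) (m : ℕ) : 2 ^ m ≤ D.N m := by
  obtain ⟨h0, -, h2, -⟩ := hP
  induction m with
  | zero => rw [h0, pow_zero]
  | succ n ih =>
    calc 2 ^ (n + 1) = 2 * 2 ^ n := by ring
      _ ≤ 2 * D.N n := Nat.mul_le_mul_left 2 ih
      _ ≤ D.N (n + 1) := h2 n

/-- The majorant sequence `N_m^{-1/16}` is dominated by the geometric sequence `(2^{-1/16})^m`. [folklore] -/
theorem rpow_N_le_geom (D : FractalCarrierData k) (hP : D.Permissible) (m : ℕ) :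
    (D.N m : ℝ) ^ (-(1 / 16 : ℝ)) ≤ ((2 : ℝ) ^ (-(1 / 16 : ℝ))) ^ m := by
  have h2 : (2 : ℝ) ^ m ≤ D.N m := by exact_mod_cast two_pow_le_N D hP m
  calc (D.N m : ℝ) ^ (-(1 / 16 : ℝ)) ≤ ((2 : ℝ) ^ m) ^ (-(1 / 16 : ℝ)) :=
        Real.rpow_le_rpow_of_nonpos (by positivity) h2 (by norm_num)
    _ = ((2 : ℝ) ^ (-(1 / 16 : ℝ))) ^ m := by
        rw [← Real.rpow_natCast, ← Real.rpow_mul (by norm_num), mul_comm, Real.rpow_mul (by norm_num),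
          Real.rpow_natCast]

/-- The shifted majorant `m ↦ N_{m+1}^{-1/16}` is summable. [folklore] -/
theorem summable_rpow_N (D : FractalCarrierData k) (hP : D.Permissible) :
    Summable fun m => (D.N (m + 1) : ℝ) ^ (-(1 / 16 : ℝ)) := by
  have hq0 : 0 ≤ (2 : ℝ) ^ (-(1 / 16 : ℝ)) := by positivity
  have hq1 : (2 : ℝ) ^ (-(1 / 16 : ℝ)) < 1 :=
    Real.rpow_lt_one_of_one_lt_of_neg (by norm_num) (by norm_num)
  refine Summable.of_nonneg_of_le (fun m => by positivity) (fun m => rpow_N_le_geom D hP (m + 1)) ?_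
  exact (summable_geometric_of_lt_one hq0 hq1).comp_injective (add_left_injective 1)

/-- With the amplitude law: `a_m / N_m ≤ N_m^{-1/16}`. [folklore] -/
theorem a_div_N_le (D : FractalCarrierData k) (hamp : ∀ m, D.a m ≤ (D.N m : ℝ) ^ (7 / 8 : ℝ)) (m : ℕ) :
    D.a m / D.N m ≤ (D.N m : ℝ) ^ (-(1 / 16 : ℝ)) := by
  have hN1 : (1 : ℝ) ≤ D.N m := by exact_mod_cast D.N_pos m
  have hN0 : (0 : ℝ) < D.N m := by linarith
  rw [div_le_iff₀ hN0]
  refine (hamp m).trans ?_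
  rw [show (D.N m : ℝ) ^ (-(1 / 16 : ℝ)) * D.N m = (D.N m : ℝ) ^ (15 / 16 : ℝ) by
    rw [mul_comm, ← Real.rpow_one_add' hN0.le (by norm_num)]; norm_num]
  exact Real.rpow_le_rpow_of_exponent_le hN1 (by norm_num)

/-- With the amplitude law: `a_m N_m^{α−1} ≤ N_m^{-1/16}` at `α = 1/16`. [folklore] -/
theorem a_mul_rpow_le (D : FractalCarrierData k) (hamp : ∀ m, D.a m ≤ (D.N m : ℝ) ^ (7 / 8 : ℝ)) (m : ℕ) :
    D.a m * (D.N m : ℝ) ^ ((((1 : ℝ≥0) / 16 : ℝ≥0) : ℝ) - 1) ≤ (D.N m : ℝ) ^ (-(1 / 16 : ℝ)) := by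
  have hN1 : (1 : ℝ) ≤ D.N m := by exact_mod_cast D.N_pos m
  have hN0 : (0 : ℝ) < D.N m := by linarith
  have e : ((((1 : ℝ≥0) / 16 : ℝ≥0) : ℝ) - 1) = -(15 / 16 : ℝ) := by push_cast; norm_num
  rw [e]
  calc D.a m * (D.N m : ℝ) ^ (-(15 / 16 : ℝ)) ≤ (D.N m : ℝ) ^ (7 / 8 : ℝ) * (D.N m : ℝ) ^ (-(15 / 16 : ℝ)) :=
        mul_le_mul_of_nonneg_right (hamp m) (by positivity)
    _ = (D.N m : ℝ) ^ (-(1 / 16 : ℝ)) := by rw [← Real.rpow_add hN0]; norm_num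

/-! ## §2 The four clauses of `Regular` -/

/-- Pointwise summability of the level series. [folklore] -/
theorem summable_level (D : FractalCarrierData k) (hP : D.Permissible)
    (hamp : ∀ m, D.a m ≤ (D.N m : ℝ) ^ (7 / 8 : ℝ)) (t : ℝ) (x : UnitAddTorus (Fin 3)) :
    Summable fun m => D.level (m + 1) t x := by
  refine Summable.of_norm_bounded (g := fun m => (k : ℝ) / (2 * Real.pi) * (D.N (m + 1) : ℝ) ^ (-(1 / 16 : ℝ)))
    ((summable_rpow_N D hP).mul_left _) fun m => ?_
  refine (norm_level_le D (m + 1) t x).trans ?_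
  rw [show (k : ℝ) * D.a (m + 1) / (2 * Real.pi * D.N (m + 1)) = k / (2 * Real.pi) * (D.a (m + 1) / D.N (m + 1)) by
    field_simp]
  exact mul_le_mul_of_nonneg_left (a_div_N_le D hamp (m + 1)) (by positivity)

/-- The summed carrier is continuous in time with values in `C^{0,1/16}`. [folklore] -/
theorem continuousInHolderOn_carrier (D : FractalCarrierData k) (hP : D.Permissible)
    (hamp : ∀ m, D.a m ≤ (D.N m : ℝ) ^ (7 / 8 : ℝ)) :
    ContinuousInHolderOn univ ((1 : ℝ≥0) / 16) D.carrier := by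
  have hr : ((1 : ℝ≥0) / 16) ≤ 1 := by
    rw [← NNReal.coe_le_coe]; push_cast; norm_num
  have h := continuousInHolderOn_tsum (S := univ) (r := (1 : ℝ≥0) / 16) (fun m => D.level (m + 1))
    (b := fun m => 7 * k * (D.N (m + 1) : ℝ) ^ (-(1 / 16 : ℝ))) (fun m => by positivity)
    ((summable_rpow_N D hP).mul_left _) (fun t _ x => summable_level D hP hamp t x)
    (fun m t _ => (eBoundedHolderNorm_level_le D (m + 1) t hr).trans (ENNReal.ofReal_le_ofReal (by
      have := a_mul_rpow_le D hamp (m + 1)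
      have hk : (0 : ℝ) ≤ 7 * k := by positivity
      nlinarith)))
    (fun m t₀ _ => tendsto_eBoundedHolderNorm_level_sub D (m + 1) t₀ hr univ)
  exact h

/-- The summed carrier is weakly divergence free at every time. [folklore] -/
theorem isWeaklyDivFree_carrier (D : FractalCarrierData k) (hP : D.Permissible)
    (hamp : ∀ m, D.a m ≤ (D.N m : ℝ) ^ (7 / 8 : ℝ)) (t : ℝ) : IsWeaklyDivFree (D.carrier t) := by
  intro θ hθ
  have hgc : Continuous (gradient θ) := hθ.gradient.continuous
  obtain ⟨M, hM⟩ := isCompact_univ.exists_bound_of_continuousOn hgc.continuousOn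
  have hM0 : 0 ≤ M := (norm_nonneg _).trans (hM 0 (mem_univ _))
  -- the integrand as a series
  have hsum := summable_level D hP hamp t
  have hpt : ∀ x, ⟪D.carrier t x, gradient θ x⟫_ℝ = ∑' m, ⟪D.level (m + 1) t x, gradient θ x⟫_ℝ := by
    intro x
    rw [FractalCarrierData.carrier, real_inner_comm, ← innerSL_apply_apply ℝ,
      ContinuousLinearMap.map_tsum _ (hsum x)]
    exact tsum_congr fun m => by rw [innerSL_apply_apply, real_inner_comm]
  simp_rw [hpt]
  -- exchange sum and integral
  have hmeas : ∀ m, AEStronglyMeasurable (fun x => ⟪D.level (m + 1) t x, gradient θ x⟫_ℝ) volume := fun m =>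
    ((isSmooth_level D (m + 1) t).continuous.inner hgc).aestronglyMeasurable
  have hbound : ∀ m x, ‖⟪D.level (m + 1) t x, gradient θ x⟫_ℝ‖ₑ ≤
      ENNReal.ofReal ((k : ℝ) / (2 * Real.pi) * M * (D.N (m + 1) : ℝ) ^ (-(1 / 16 : ℝ))) := by
    intro m x
    rw [← ofReal_norm]
    refine ENNReal.ofReal_le_ofReal ?_
    calc ‖⟪D.level (m + 1) t x, gradient θ x⟫_ℝ‖ ≤ ‖D.level (m + 1) t x‖ * ‖gradient θ x‖ := norm_inner_le_norm _ _
      _ ≤ (k * D.a (m + 1) / (2 * Real.pi * D.N (m + 1))) * M :=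
          mul_le_mul (norm_level_le D (m + 1) t x) (hM x (mem_univ x)) (norm_nonneg _)
            (by have := D.a_pos (m + 1); have := D.N_pos (m + 1); positivity)
      _ = (k : ℝ) / (2 * Real.pi) * M * (D.a (m + 1) / D.N (m + 1)) := by field_simp
      _ ≤ (k : ℝ) / (2 * Real.pi) * M * (D.N (m + 1) : ℝ) ^ (-(1 / 16 : ℝ)) :=
          mul_le_mul_of_nonneg_left (a_div_N_le D hamp (m + 1)) (by positivity)
  have hfin : ∑' m, ∫⁻ x, ‖⟪D.level (m + 1) t x, gradient θ x⟫_ℝ‖ₑ ≠ ∞ := by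
    refine ne_top_of_le_ne_top (b := ∑' m, ENNReal.ofReal ((k : ℝ) / (2 * Real.pi) * M * (D.N (m + 1) : ℝ) ^ (-(1 / 16 : ℝ)))) ?_ ?_
    · rw [← ENNReal.ofReal_tsum_of_nonneg (fun m => by positivity) ((summable_rpow_N D hP).mul_left _)]
      exact ENNReal.ofReal_ne_top
    · refine ENNReal.tsum_le_tsum fun m => ?_
      calc ∫⁻ x, ‖⟪D.level (m + 1) t x, gradient θ x⟫_ℝ‖ₑ ≤ ∫⁻ _ : UnitAddTorus (Fin 3),
            ENNReal.ofReal ((k : ℝ) / (2 * Real.pi) * M * (D.N (m + 1) : ℝ) ^ (-(1 / 16 : ℝ))) :=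
            lintegral_mono fun x => hbound m x
        _ = _ := by rw [lintegral_const, measure_univ, mul_one]
  rw [integral_tsum hmeas hfin]
  simp_rw [isWeaklyDivFree_level D _ t θ hθ, tsum_zero]

/-- **Registered stub `stub_regular` of the crux `PermissibleFractalCarrier` (K3)**: a `Permissible`
fractal-carrier datum with the amplitude law `a_m ≤ N_m^{7/8}` is `Regular` — the level series converges
pointwise, the summed carrier is `C⁰_t C^{0,1/16}_x`, time-periodic with period `physPeriod 1`, and weakly
divergence free at every time. [cite: ArmstrongVicol2025, Thm. 1.1 (regularity class of the carrier) and §3] -/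
theorem stub_regular : ∀ k (D : LatticeShear.FractalCarrierData k), D.Permissible →
    (∀ m, D.a m ≤ (D.N m : ℝ) ^ (7 / 8 : ℝ)) → D.Regular := by
  intro k D hP hamp
  refine ⟨fun t x => summable_level D hP hamp t x, (1 : ℝ≥0) / 16, by positivity,
    continuousInHolderOn_carrier D hP hamp, ⟨D.physPeriod 1, physPeriod_pos D 1, periodic_carrier D hP⟩,
    fun t => isWeaklyDivFree_carrier D hP hamp t⟩

end Summit.AnomalousDissipation.AnomalousDissipation.Theorems.SolenoidalFractalHomogenisation.PermissibleCarrier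

end
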